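import Summits.HodgeConjecture.HodgeCM.Model.Binders.Gen12PinsTotalP2_1

/-! PORT of `HodgeCM/Model/Binders/Gen12PinsTotalP2.lean` (HodgeCMPerL run 82) — part 2: continuation of `Summits.HodgeConjecture.HodgeCM.Model.Binders.Gen12PinsTotalP2_1` (split at a top-level declaration boundary by port_pkg.py; scope re-opened below; declarations unchanged). -/

-- port_pkg: scope re-opened for this part (file-level context, then the namespace/section stack open at the cut)
set_option autoImplicit false
noncomputable section
open MeasureTheory NumberField MulAction
open scoped Matrix InnerProductSpace
namespace HodgeCM.Model
open HodgeCM HodgeCM.Universe HodgeCM.Adelic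
open Literature.NumberTheory.Weil1964
open Literature.NumberTheory.Automorphic (piSchwartzBruhat)
open Literature.NumberTheory.Automorphic.UnitaryGroup (archIsotropy archIsotropyProj archKappa archSectionU21CM)
open Literature.NumberTheory.GelbartRogawski1991.UnitaryDualPair
open Literature.RepresentationTheory.HeisenbergGroup
open Literature.Geometry.ComplexHyperbolic.BallModel (U21 x₀ Jac)
open Literature.AlgebraicGeometry.HodgeTheory
open Literature.NumberTheory.Automorphic.PicardCM
open Literature.NumberTheory.Transcendental (Arapura2012_Cor_15_4_6)
open HodgeCM.Model.ThetaSpace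
open HodgeCM.Model.ArchSideTerm
namespace Gen12PinsP2
variable
  (G : ∀ {L : CMField} {ι₁ : L →+* ℂ} (_V : HermSpace3 L ι₁) (_c : SeesawCtx L), Prop)
  (hG : ∀ {L : CMField} {ι₁ : L →+* ℂ} (V : HermSpace3 L ι₁) (c : SeesawCtx L),
    G V c → (∀ j, 0 < (ι₁ (dW c.D j)).re) ∨ ∀ j, (ι₁ (dW c.D j)).re < 0)
  (hGR : ∀ {L : CMField} {ι₁ : L →+* ℂ} (V : HermSpace3 L ι₁) (c : SeesawCtx L),
    (cmSplittingDatum (L : Type) finProdFinEquiv (frameD V) (frameD_real V) (frameD_ne V) (dW c.D) (dW_real c.D)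
      (dW_ne c.D)).CompatibleSplitting)
  (η : ∀ {L : CMField} {ι₁ : L →+* ℂ} (V : HermSpace3 L ι₁) (c : SeesawCtx L),
    CMAdelic (L : Type) (frameD V) × CMAdelic (L : Type) (dW c.D) →* ℂˣ)
  (hη : ∀ {L : CMField} {ι₁ : L →+* ℂ} (V : HermSpace3 L ι₁) (c : SeesawCtx L),
    ∀ γU ∈ CMRat (L : Type) (frameD V), ∀ γ ∈ CMRat (L : Type) (dW c.D), η V c (γU, γ) = 1)
  (hηc : ∀ {L : CMField} {ι₁ : L →+* ℂ} (V : HermSpace3 L ι₁) (c : SeesawCtx L), Continuous fun p => ((η V c p : ℂˣ) : ℂ))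
  (ν : ∀ {L : CMField} {ι₁ : L →+* ℂ} (V : HermSpace3 L ι₁) (_c : SeesawCtx L), CMAdelic (L : Type) (frameD V) →* ℂˣ)
  (hν : ∀ {L : CMField} {ι₁ : L →+* ℂ} (V : HermSpace3 L ι₁) (c : SeesawCtx L), ∀ γU ∈ CMRat (L : Type) (frameD V), ν V c γU = 1)
  (hνc : ∀ {L : CMField} {ι₁ : L →+* ℂ} (V : HermSpace3 L ι₁) (c : SeesawCtx L), Continuous fun v => ((ν V c v : ℂˣ) : ℂ))
  (ν' : ∀ {L : CMField} {ι₁ : L →+* ℂ} (V : HermSpace3 L ι₁) (_c : SeesawCtx L), CMAdelic (L : Type) (frameD V) →* ℂˣ)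
  (hν' : ∀ {L : CMField} {ι₁ : L →+* ℂ} (V : HermSpace3 L ι₁) (c : SeesawCtx L), ∀ γU ∈ CMRat (L : Type) (frameD V), ν' V c γU = 1)
  (hν'c : ∀ {L : CMField} {ι₁ : L →+* ℂ} (V : HermSpace3 L ι₁) (c : SeesawCtx L), Continuous fun v => ((ν' V c v : ℂˣ) : ℂ))
  (hGR₀ : ∀ {L : CMField} {ι₁ : L →+* ℂ} (V : HermSpace3 L ι₁) (c : SeesawCtx L),
    (cmSplittingDatum (L : Type) (e₁) (frameD V) (frameD_real V) (frameD_ne V) (lineVec (L : Type) (dW c.D 0))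
      (fun _ => dW_real c.D 0) (fun _ => dW_ne c.D 0)).CompatibleSplitting)
  (hGR₁ : ∀ {L : CMField} {ι₁ : L →+* ℂ} (V : HermSpace3 L ι₁) (c : SeesawCtx L),
    (cmSplittingDatum (L : Type) (e₁) (frameD V) (frameD_real V) (frameD_ne V) (lineVec (L : Type) (dW c.D 1))
      (fun _ => dW_real c.D 1) (fun _ => dW_ne c.D 1)).CompatibleSplitting)
  (hGR₂ : ∀ {L : CMField} {ι₁ : L →+* ℂ} (V : HermSpace3 L ι₁) (c : SeesawCtx L),
    (cmSplittingDatum (L : Type) (e₁) (frameD V) (frameD_real V) (frameD_ne V) (lineVec (L : Type) (dW' c.D 0))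
      (fun _ => dW'_real c.D 0) (fun _ => dW'_ne c.D 0)).CompatibleSplitting)
  (hGR₃ : ∀ {L : CMField} {ι₁ : L →+* ℂ} (V : HermSpace3 L ι₁) (c : SeesawCtx L),
    (cmSplittingDatum (L : Type) (e₁) (frameD V) (frameD_real V) (frameD_ne V) (lineVec (L : Type) (dW' c.D 1))
      (fun _ => dW'_real c.D 1) (fun _ => dW'_ne c.D 1)).CompatibleSplitting)
  (AG : ∀ {L : CMField} {ι₁ : L →+* ℂ} (V : HermSpace3 L ι₁) (c : SeesawCtx L), G V c → ∀ k : Fin 4,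
    ArchLineInput V (lineRepT' V c.D (hGR V c) (hGR₀ V c) (hGR₁ V c) (hGR₂ V c) (hGR₃ V c) (η V c) (ν V c) (ν' V c) k))
variable (hHD : exists_isReal_hodgeModel) (hI : hodgePQ_independent_of_hodgeModel)
  (h₁ : BallQuotientUniformised)  (h₃ : CMAbelianVarietyRealised)
  (h : Bool) (hA : Arapura2012_Cor_15_4_6) (μ : ∀ {L : CMField}, SeesawCtx L → Fin 4 → InfinitePlace L → ℤ)
/-- **E's binder `real34` AT THE TOTAL PINS** (quantified form) from the residual record at each good context. -/
theorem real34_total (hGc : ∀ {L : CMField} {ι₁ : L →+* ℂ} (V : HermSpace3 L ι₁) (c : SeesawCtx L),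
      (pinT hHD hI h₁ h₃ h hA (Gen12Pins.Wg @hGR @η @hη @hηc @Gen12Pins.τSyl @Gen12Pins.TSyl @Gen12Pins.hTSyl) (SInstance.SGPT' @G @hG @hGR @η @hη @hηc @ν @hν @hνc @ν' @hν' @hν'c @hGR₀ @hGR₁ @hGR₂ @hGR₃ @AG) μ).GoodCtx ι₁ c → G V c)
    (hpc : (picardCMUniverse hHD hI h₁ h₃).Fact_pull_comp)
    (hcup : (picardCMUniverse hHD hI h₁ h₃).Fact_pull_cup) (hph : (picardCMUniverse hHD hI h₁ h₃).Fact_pull_hodge)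
    (R : ∀ {L : CMField} {ι₁ : L →+* ℂ} (V : HermSpace3 L ι₁) (c : SeesawCtx L) (hV : IsAnisotropic L V.Hm)
      (hc : (pinT hHD hI h₁ h₃ h hA (Gen12Pins.Wg @hGR @η @hη @hηc @Gen12Pins.τSyl @Gen12Pins.TSyl @Gen12Pins.hTSyl) (SInstance.SGPT' @G @hG @hGR @η @hη @hηc @ν @hν @hνc @ν' @hν' @hν'c @hGR₀ @hGR₁ @hGR₂ @hGR₃ @AG) μ).GoodCtx ι₁ c), Module.finrank ℚ c.K = 6 →
        Real34GuardedResidual @G @hG @hGR @η @hη @hηc @ν @hν @hνc @ν' @hν' @hν'c @hGR₀ @hGR₁ @hGR₂ @hGR₃ @AG hHD hI h₁ h₃ h hA @μ V c hV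
          (hGc V c hc))
    {L : CMField} {ι₁ : L →+* ℂ} (V : HermSpace3 L ι₁) (c : SeesawCtx L)
    (hc : (pinT hHD hI h₁ h₃ h hA (Gen12Pins.Wg @hGR @η @hη @hηc @Gen12Pins.τSyl @Gen12Pins.TSyl @Gen12Pins.hTSyl) (SInstance.SGPT' @G @hG @hGR @η @hη @hηc @ν @hν @hνc @ν' @hν' @hν'c @hGR₀ @hGR₁ @hGR₂ @hGR₃ @AG) μ).GoodCtx ι₁ c) (hK : Module.finrank ℚ c.K = 6) :
    Nonempty ((pinT hHD hI h₁ h₃ h hA (Gen12Pins.Wg @hGR @η @hη @hηc @Gen12Pins.τSyl @Gen12Pins.TSyl @Gen12Pins.hTSyl) (SInstance.SGPT' @G @hG @hGR @η @hη @hηc @ν @hν @hνc @ν' @hν' @hν'c @hGR₀ @hGR₁ @hGR₂ @hGR₃ @AG) μ).Real34FunBridge V c) :=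
  real34_of_thetaSat hHD hI h₁ h₃ h hA (Gen12Pins.Wg @hGR @η @hη @hηc @Gen12Pins.τSyl @Gen12Pins.TSyl @Gen12Pins.hTSyl) (SInstance.SGPT' @G @hG @hGR @η @hη @hηc @ν @hν @hνc @ν' @hν' @hν'c @hGR₀ @hGR₁ @hGR₂ @hGR₃ @AG) μ hpc hcup hph (fun V c hV hc hK => (R V c hV hc hK).toJunctions) V c hc hK

/-- **E's binder `real34` IN E's OWN TEXT at the total pins of record.** -/
theorem real34_totalE (hGc : ∀ {L : CMField} {ι₁ : L →+* ℂ} (V : HermSpace3 L ι₁) (c : SeesawCtx L),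
      (pinT hHD hI h₁ h₃ h hA (Gen12Pins.Wg @hGR @η @hη @hηc @Gen12Pins.τSyl @Gen12Pins.TSyl @Gen12Pins.hTSyl) (SInstance.SGPT' @G @hG @hGR @η @hη @hηc @ν @hν @hνc @ν' @hν' @hν'c @hGR₀ @hGR₁ @hGR₂ @hGR₃ @AG) μ).GoodCtx ι₁ c → G V c)
    (hpc : (picardCMUniverse hHD hI h₁ h₃).Fact_pull_comp)
    (hcup : (picardCMUniverse hHD hI h₁ h₃).Fact_pull_cup) (hph : (picardCMUniverse hHD hI h₁ h₃).Fact_pull_hodge)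
    (R : ∀ {L : CMField} {ι₁ : L →+* ℂ} (V : HermSpace3 L ι₁) (c : SeesawCtx L) (hV : IsAnisotropic L V.Hm)
      (hc : (pinT hHD hI h₁ h₃ h hA (Gen12Pins.Wg @hGR @η @hη @hηc @Gen12Pins.τSyl @Gen12Pins.TSyl @Gen12Pins.hTSyl) (SInstance.SGPT' @G @hG @hGR @η @hη @hηc @ν @hν @hνc @ν' @hν' @hν'c @hGR₀ @hGR₁ @hGR₂ @hGR₃ @AG) μ).GoodCtx ι₁ c), Module.finrank ℚ c.K = 6 →
        Real34GuardedResidual @G @hG @hGR @η @hη @hηc @ν @hν @hνc @ν' @hν' @hν'c @hGR₀ @hGR₁ @hGR₂ @hGR₃ @AG hHD hI h₁ h₃ h hA @μ V c hV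
          (hGc V c hc)) :
    ∀ {L : CMField} {ι₁ : L →+* ℂ} (V : HermSpace3 L ι₁) (c : SeesawCtx L),
      (thetaModelOf hHD hI h₁ h₃ h (embOf hHD hI h₁ h₃) (coverOf hHD hI h₁ h₃ hA) (wmOfInput (Gen12Pins.Wg @hGR @η @hη @hηc @Gen12Pins.τSyl @Gen12Pins.TSyl @Gen12Pins.hTSyl))
        (thetaOf _ (thetaClassInputOf _ (fun V c => thetaSpaceInputOf hHD hI h₁ h₃ (SInstance.SGPT' @G @hG @hGR @η @hη @hηc @ν @hν @hνc @ν' @hν' @hν'c @hGR₀ @hGR₁ @hGR₂ @hGR₃ @AG) V c))) (d12Of μ) (d34Of μ)).GoodCtx ι₁ c →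
      Module.finrank ℚ c.K = 6 →
      Nonempty ((thetaModelOf hHD hI h₁ h₃ h (embOf hHD hI h₁ h₃) (coverOf hHD hI h₁ h₃ hA) (wmOfInput (Gen12Pins.Wg @hGR @η @hη @hηc @Gen12Pins.τSyl @Gen12Pins.TSyl @Gen12Pins.hTSyl))
        (thetaOf _ (thetaClassInputOf _ (fun V c => thetaSpaceInputOf hHD hI h₁ h₃ (SInstance.SGPT' @G @hG @hGR @η @hη @hηc @ν @hν @hνc @ν' @hν' @hν'c @hGR₀ @hGR₁ @hGR₂ @hGR₃ @AG) V c))) (d12Of μ) (d34Of μ)).Real34FunBridge V c) :=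
  fun V c hc hK => real34_total @G @hG @hGR @η @hη @hηc @ν @hν @hνc @ν' @hν' @hν'c @hGR₀ @hGR₁ @hGR₂ @hGR₃ @AG hHD hI h₁ h₃ h hA @μ hGc hpc hcup hph R V c hc hK

end Gen12PinsP2

end HodgeCM.Model

end
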